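import Mathlib
import Literature.Analysis.FluidPDE.Tao2016AveragedNS.ShiftSetCascadeFlows
import HarnessLib

/-!
# Shift-set pseudo-flows `PseudoFlowOnShift 𝕊`: the INERT PHANTOM FRONT — the (front) clause
  `FrontExistsOn 𝕊` from gap data on `𝕊` and admissible slack weights (helper for item
  stmt-NavierStokesRegularity-22988 `GappedFrontRobustV2Flat`, crux K_B♭ of route TaoLadderRungTwoFlat)

The `𝕊`-parametrised, ROUTE-FREE version of `Theorems/TaoLadderRungThreeGappedFrontRobustInertPhantomFront.lean`
(typer, one-way `S`; that module imports the route file of TaoLadderRungThree, this one imports only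
Literature). An exact zero-slack flow `(S, F)` on `𝕊` from `(S₀, ½S₀²)` carrying the inert phantom energy
`φ = F₀ − ½S₀² ∈ [0, B₀]` as a constant is a defect-free pseudo-flow on `𝕊` from `(S₀, F₀)` with slack
`B₀` (`pseudoFlowOnShift_add_phantom`; the (4.5) weight of `√φ` is bounded because the slack weights
are: `B₀ ≤ η · slackWeight` and `∀ L, ∃ C, ∀ k, (1+(1+ε₀)^{10k}) √(slackWeight L k) ≤ C`); hence the
(exist₀) clause of `GapDataOn 𝕊` gives `FrontExistsOn 𝕊` for every margin `η > 0` and every such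
envelope (`frontExistsOn_of_gapDataOn`).

HONEST FRAMING: elementary facts about Tao-type MODEL lattice pseudo-flows (Tao 2016 §4 Lemma 4.1 (4.5),
(4.8)–(4.10)) on a general shift set; nothing here concerns the Navier–Stokes equations; nothing is
asserted about any table (p1 g12).
-/

noncomputable section

-- the sub-problem namespace `Summit.NavierStokesRegularity.NavierStokesRegularity` repeats the summit name by design (D-0017)
set_option linter.dupNamespace false

namespace Summit.NavierStokesRegularity.NavierStokesRegularity.Theorems

open Set MeasureTheory intervalIntegral Literature.Analysis.FluidPDE Literature.Analysis.FluidPDE.TaoCascade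

namespace GappedFrontRobustOn

variable {m : ℕ} {𝕊 : Finset (ℤ × ℤ × ℤ)}

/-- **An exact flow on `𝕊` carrying inert phantom energy is a defect-free pseudo-flow on `𝕊`**: if
`(S, F)` is a zero-slack defect-free flow on `[0, τ]` from `(S₀, ½S₀²)` and `0 ≤ φ ≤ B₀` with the (4.5)
weight of `√φ` bounded, then `(S, F + φ)` is a defect-free flow from `(S₀, ½S₀² + φ)` with slack `B₀`.
[cite: Tao2016AveragedNS, §4 Lemma 4.1 (4.5), (4.8)–(4.10)] -/
theorem pseudoFlowOnShift_add_phantom {τ ε₀ : ℝ} {α : Fin m → Fin m → Fin m → ℤ × ℤ × ℤ → ℝ}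
    {S₀ B₀ φ : Fin m → ℤ → ℝ} {S F : Fin m → ℤ → ℝ → ℝ}
    (hq : 0 < 1 + ε₀)
    (h : PseudoFlowOnShift 𝕊 τ ε₀ α 0 0 S₀ (fun i k => (1 / 2) * S₀ i k ^ 2) (fun _ _ => 0) S F)
    (hφ0 : ∀ i k, 0 ≤ φ i k) (hφB : ∀ i k, φ i k ≤ B₀ i k)
    (hφw : ∃ C : ℝ, ∀ (i : Fin m) (k : ℤ), (1 + (1 + ε₀) ^ ((10 : ℝ) * k)) * Real.sqrt (φ i k) ≤ C) :
    PseudoFlowOnShift 𝕊 τ ε₀ α 0 0 S₀ (fun i k => (1 / 2) * S₀ i k ^ 2 + φ i k) B₀ S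
      (fun i k s => F i k s + φ i k) where
  contDiffOn_S := h.contDiffOn_S
  contDiffOn_F i k := (h.contDiffOn_F i k).add contDiffOn_const
  nonneg_F i k s hs := add_nonneg (h.nonneg_F i k s hs) (hφ0 i k)
  apriori_S := h.apriori_S
  apriori_F := by
    obtain ⟨M, hM⟩ := h.apriori_F
    obtain ⟨C, hC⟩ := hφw
    refine ⟨M + C, fun s hs i k => ?_⟩
    have hw : 0 ≤ 1 + (1 + ε₀) ^ ((10 : ℝ) * k) := by
      have := Real.rpow_pos_of_pos hq ((10 : ℝ) * k)
      linarith
    -- √(a + b) ≤ √a + √b for a, b ≥ 0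
    have hsqrt : Real.sqrt (F i k s + φ i k) ≤ Real.sqrt (F i k s) + Real.sqrt (φ i k) := by
      have ha := h.nonneg_F i k s hs
      have hb := hφ0 i k
      have h1 : F i k s + φ i k ≤ (Real.sqrt (F i k s) + Real.sqrt (φ i k)) ^ 2 := by
        nlinarith [Real.sq_sqrt ha, Real.sq_sqrt hb, Real.sqrt_nonneg (F i k s), Real.sqrt_nonneg (φ i k)]
      calc Real.sqrt (F i k s + φ i k) ≤ Real.sqrt ((Real.sqrt (F i k s) + Real.sqrt (φ i k)) ^ 2) :=
            Real.sqrt_le_sqrt h1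
        _ = Real.sqrt (F i k s) + Real.sqrt (φ i k) := Real.sqrt_sq (by positivity)
    calc (1 + (1 + ε₀) ^ ((10 : ℝ) * k)) * Real.sqrt (F i k s + φ i k)
        ≤ (1 + (1 + ε₀) ^ ((10 : ℝ) * k)) * (Real.sqrt (F i k s) + Real.sqrt (φ i k)) :=
          mul_le_mul_of_nonneg_left hsqrt hw
      _ = (1 + (1 + ε₀) ^ ((10 : ℝ) * k)) * Real.sqrt (F i k s) +
            (1 + (1 + ε₀) ^ ((10 : ℝ) * k)) * Real.sqrt (φ i k) := by ring
      _ ≤ M + C := add_le_add (hM s hs i k) (hC i k)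
  init_S := h.init_S
  init_F i k := by rw [h.init_F i k]
  motion i k s hs := by
    have h1 := h.motion i k s hs
    simp only [zero_mul] at h1 ⊢
    exact h1
  energy i k s hs := by
    rw [derivWithin_add_const]
    exact h.energy i k s hs
  defect_lower i k s hs := (h.defect_lower i k s hs).trans (le_add_of_nonneg_right (hφ0 i k))
  defect_upper i k s hs := by
    have h1 := h.defect_upper i k s hs
    simp only [zero_mul, add_zero] at h1 ⊢
    linarith [hφB i k]

/-- **Inert phantom front on `𝕊`** (the (front) clause `FrontExistsOn 𝕊` for every margin `η > 0`
and every envelope with admissible slack weights; any number of modes): from gap data on `𝕊`,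
defect-free flows on `𝕊` exist on the whole clock window `[0, c]` from every ball state with
admissible slack and compatible start energies.
[cite: Tao2016AveragedNS, §4 Lemma 4.1 (4.5), (4.8)–(4.10); cell vocabulary `GapDataOn` (exist₀)] -/
theorem frontExistsOn_of_gapDataOn {ε₀ : ℝ} {i₀ : Fin m}
    {α : Fin m → Fin m → Fin m → ℤ × ℤ × ℤ → ℝ} {X₀ : Fin m → ℝ} {Z : Set (Fin m → ℤ → ℝ)}
    {w : ℤ → ℝ} {r ρ θ₀ θ c₀ c : ℝ} {env₀ : ℤ → ℝ} (hε₀ : 0 < ε₀)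
    (hgap : GapDataOn 𝕊 ε₀ i₀ α X₀ Z w r ρ θ₀ θ c₀ c env₀) {η : ℝ} {env : ℤ → ℝ} (hη : 0 < η)
    (hdec : ∀ L : ℕ, ∃ C : ℝ, ∀ k : ℤ,
      (1 + (1 + ε₀) ^ ((10 : ℝ) * k)) * Real.sqrt (slackWeight ε₀ θ c env L k) ≤ C) :
    FrontExistsOn 𝕊 ε₀ θ c η α (ballDesc Z w r) env := by
  intro L S₀ F₀ B₀ hball hB hF
  have hq : (0 : ℝ) < 1 + ε₀ := by linarith
  obtain ⟨-, -, -, -, -, -, -, -, -, -, -, hex, -⟩ := hgap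
  obtain ⟨z, hz, hzr⟩ := hball
  obtain ⟨S, F, hSF⟩ := hex S₀ ⟨z, hz, hzr⟩
  obtain ⟨C, hC⟩ := hdec L
  -- the inert phantom energy `φ = F₀ − ½S₀² ∈ [0, B₀]`
  set φ : Fin m → ℤ → ℝ := fun i k => F₀ i k - (1 / 2) * S₀ i k ^ 2 with hφ
  have hφ0 : ∀ i k, 0 ≤ φ i k := fun i k => by have := (hF i k).1; simp only [hφ]; linarith
  have hφB : ∀ i k, φ i k ≤ B₀ i k := fun i k => by have := (hF i k).2; simp only [hφ]; linarith
  have hφw : ∃ C' : ℝ, ∀ (i : Fin m) (k : ℤ),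
      (1 + (1 + ε₀) ^ ((10 : ℝ) * k)) * Real.sqrt (φ i k) ≤ C' := by
    refine ⟨Real.sqrt η * C, fun i k => ?_⟩
    have hw : 0 ≤ 1 + (1 + ε₀) ^ ((10 : ℝ) * k) := by
      have := Real.rpow_pos_of_pos hq ((10 : ℝ) * k)
      linarith
    have h1 : Real.sqrt (φ i k) ≤ Real.sqrt η * Real.sqrt (slackWeight ε₀ θ c env L k) := by
      rw [← Real.sqrt_mul hη.le]
      exact Real.sqrt_le_sqrt ((hφB i k).trans (hB i k).2)
    calc (1 + (1 + ε₀) ^ ((10 : ℝ) * k)) * Real.sqrt (φ i k)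
        ≤ (1 + (1 + ε₀) ^ ((10 : ℝ) * k)) *
            (Real.sqrt η * Real.sqrt (slackWeight ε₀ θ c env L k)) :=
          mul_le_mul_of_nonneg_left h1 hw
      _ = Real.sqrt η *
            ((1 + (1 + ε₀) ^ ((10 : ℝ) * k)) * Real.sqrt (slackWeight ε₀ θ c env L k)) := by ring
      _ ≤ Real.sqrt η * C := mul_le_mul_of_nonneg_left (hC k) (Real.sqrt_nonneg η)
  have hflow := pseudoFlowOnShift_add_phantom hq hSF hφ0 hφB hφw
  -- the start energies `½S₀² + φ = F₀`
  have hF₀ : (fun i k => (1 / 2) * S₀ i k ^ 2 + φ i k) = F₀ := by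
    funext i k; simp only [hφ]; ring
  rw [hF₀] at hflow
  exact ⟨S, _, hflow⟩

end GappedFrontRobustOn

end Summit.NavierStokesRegularity.NavierStokesRegularity.Theorems

end
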